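import Mathlib
import HarnessLib
import Literature.Probability.Independence.Grouping

/-!
# Block factors of an i.i.d. sequence: stationarity of windows, `m`-dependence, and their block sums as functions of disjoint windows

HONEST FRAMING: exact (Metropolis-corrected) sampling algorithms for lattice gauge theory;
figures of merit are autocorrelation/cost numbers at stated couplings and volumes; no
continuum-physics claim.

Venture `LatticeQCDFlow` (cell pub-lqcd), sub-topic `Scoring`; FANOUT row 16 (`su2-base`, the
4D SU(2) baselines), GEN-7.  NEW WORK of the cell over Mathlib and the Literature's grouping lemma
(`Literature.Probability.Independence.iIndepFun_comp_of_pairwise_disjoint`, Kallenberg Cor. 3.7);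
nothing here is cited as a fact.  Printed counterpart NAMED ONLY: Lehmann, *Elements of Large-Sample
Theory* (1999) §2.8, eq. (2.8.6) and Problem 8.2 (block factors of an i.i.d. sequence are stationary
and `m`-dependent; held, p. 92).

First file of the LAW-OF-THE-ERROR packet (GEN-6 derived the VARIANCE of the windowed `τ_int`
estimator in the Gaussian model — `Scoring/MadrasSokalErrorFormula`, `…RatioVariance` — and listed
as NOT CLAIMED 'a CLT or any distributional statement for τ̂'; this packet supplies the central
limit theorems).  The probabilistic MODEL of the packet is typed here: an i.i.d. driving sequence
`ξ : ℕ → Ω → S` (Mathlib's CLT hypotheses `iIndepFun ξ P`, `IdentDistrib (ξ i) (ξ 0) P P`) and the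
observed series `X_i = F(ξ_i, …, ξ_{i+m})`, a measurable function of a sliding window — moving
averages `MA(m)`, their lag products `X_i X_{i+t}` (windows of length `m + t + 1`), any finite-range
functional.  Such a series is (strictly) stationary and `m`-DEPENDENT; this file proves exactly the
second-order consequences the CLT needs, and the Bernstein-block bookkeeping: a centred block sum
`Σ_{l<n} (X_{a+l} − μ)` is ONE measurable function of ONE window of length `n + m`, so blocks at
`(n+m)`-separated positions are independent and identically distributed.

## Contents

* `window ξ r i` (`ω ↦ (ξ_{i+l}(ω))_{l<r}`), `blockFactor F ξ i` (`X_i = F ∘ window ξ (m+1) i`);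
  `identDistrib_window` (every window has the law of the window at `0`, `IdentDistrib.pi`),
  `iIndepFun_window` / `indepFun_window` (separated windows are independent, by grouping).
* `identDistrib_blockFactor`, `identDistrib_blockFactor_pair`, `memLp_blockFactor`,
  **`integral_blockFactor`** (`E X_i = E X_0`), **`covariance_blockFactor_add`**
  (`cov[X_i, X_{i+k}] = cov[X_0, X_k]`), **`indepFun_blockFactor`** (`X_i ⟂ X_j` for `j ≥ i + m + 1`).
* `cblockSum X μ a n = Σ_{l<n} (X_{a+l} − μ)`; `cblockSum_add`, `cblockSum_mul` (splitting /
  concatenation); `blockSumMap`, **`cblockSum_blockFactor_eq`** (a block sum is `blockSumMap` of one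
  window of length `n + m`); `measurable_cblockSum`, **`identDistrib_cblockSum`**,
  **`iIndepFun_cblockSum`**, `iIndepFun_cblockSum_periodic` (blocks of length `n` with period
  `p ≥ n + m` are mutually independent), `memLp_cblockSum`, `integral_cblockSum` (mean zero at
  `μ = E X_0`).

NOT CLAIMED: strict stationarity of the whole path law (only windows / finitely many coordinates,
which is all that is used); general (non-functional) `m`-dependent sequences; anything about a
particular `F`.  Companion files: `BlockFactorSecondMoments` (variances, long-run variance),
`BlockFactorCLT` (the theorem).
-/

noncomputable section

open MeasureTheory ProbabilityTheory Filter Finset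
open scoped Topology

namespace Summit.Ventures.LatticeQCDFlow.Scoring

variable {Ω : Type*} [MeasurableSpace Ω] {P : Measure Ω}
variable {S : Type*} [MeasurableSpace S]

/-! ## Windows and block factors -/

/-- The WINDOW of length `r` at position `i` of a sequence `ξ`: `ω ↦ (ξ_{i}, …, ξ_{i+r-1})(ω)`.
[ours] -/
def window (ξ : ℕ → Ω → S) (r i : ℕ) : Ω → (Fin r → S) :=
  fun ω l => ξ (i + l) ω

/-- An `(m+1)`-BLOCK FACTOR of the sequence `ξ`: `X_i = F(ξ_i, …, ξ_{i+m})` (Lehmann 1999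
eq. (2.8.6); moving averages, lag products of moving averages, …). [ours] -/
def blockFactor {m : ℕ} (F : (Fin (m + 1) → S) → ℝ) (ξ : ℕ → Ω → S) (i : ℕ) : Ω → ℝ :=
  fun ω => F (window ξ (m + 1) i ω)

omit [MeasurableSpace Ω] [MeasurableSpace S] in
/-- Unfolding lemma for `window`. -/
theorem window_apply (ξ : ℕ → Ω → S) (r i : ℕ) (ω : Ω) (l : Fin r) :
    window ξ r i ω l = ξ (i + l) ω := rfl

omit [MeasurableSpace Ω] [MeasurableSpace S] in
/-- Unfolding lemma for `blockFactor`. -/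
theorem blockFactor_apply {m : ℕ} (F : (Fin (m + 1) → S) → ℝ) (ξ : ℕ → Ω → S) (i : ℕ) (ω : Ω) :
    blockFactor F ξ i ω = F (window ξ (m + 1) i ω) := rfl

omit [MeasurableSpace Ω] [MeasurableSpace S] in
/-- A window of a window: the length-`r` window at position `a` of `ξ`, read at `l + j`, is the
length-`r'` window at position `a + l` read at `j`. -/
theorem window_add (ξ : ℕ → Ω → S) {r r' : ℕ} (a l : ℕ) (ω : Ω) (j : Fin r')
    (h : l + j < r) : window ξ r a ω ⟨l + j, h⟩ = window ξ r' (a + l) ω j := by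
  simp only [window_apply, add_assoc]

section Measurable

variable {ξ : ℕ → Ω → S}

/-- Windows are measurable. -/
theorem measurable_window (hξ : ∀ i, Measurable (ξ i)) (r i : ℕ) :
    Measurable (window ξ r i) :=
  measurable_pi_lambda _ fun l => hξ (i + l)

/-- Block factors are measurable. -/
theorem measurable_blockFactor (hξ : ∀ i, Measurable (ξ i)) {m : ℕ} {F : (Fin (m + 1) → S) → ℝ}
    (hF : Measurable F) (i : ℕ) : Measurable (blockFactor F ξ i) :=
  hF.comp (measurable_window hξ (m + 1) i)

end Measurable

/-! ## Stationarity and independence of windows of an i.i.d. sequence -/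

section IID

variable {ξ : ℕ → Ω → S}

/-- **Stationarity of windows**: for an i.i.d. sequence every window of length `r` has the law
of the window at position `0`. -/
theorem identDistrib_window (hind : iIndepFun ξ P) (hid : ∀ i, IdentDistrib (ξ i) (ξ 0) P P)
    (r i : ℕ) : IdentDistrib (window ξ r i) (window ξ r 0) P P := by
  have h1 : iIndepFun (fun l : Fin r => ξ (i + l)) P :=
    hind.precomp (g := fun l : Fin r => i + (l : ℕ)) fun a b hab => Fin.ext (by simpa using hab)
  have h0 : iIndepFun (fun l : Fin r => ξ (0 + l)) P :=
    hind.precomp (g := fun l : Fin r => 0 + (l : ℕ)) fun a b hab => Fin.ext (by simpa using hab)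
  exact IdentDistrib.pi (fun l => (hid (i + l)).trans (hid (0 + l)).symm) h1 h0

/-- **Independence of separated windows** (grouping): windows of length `r` at positions `a j`
that are pairwise `r`-separated are mutually independent. -/
theorem iIndepFun_window (hξ : ∀ i, Measurable (ξ i)) (hind : iIndepFun ξ P) {κ : Type*}
    {a : κ → ℕ} {r : ℕ} (ha : Pairwise fun j j' => a j + r ≤ a j' ∨ a j' + r ≤ a j) :
    iIndepFun (fun j => window ξ r (a j)) P := by
  have h := Literature.Probability.Independence.iIndepFun_comp_of_pairwise_disjoint hξ hind
    (α := fun _ : κ => Fin r) (fun j l => a j + (l : ℕ)) ?_ (T := fun _ => Fin r → S)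
    (fun _ => id) fun _ => measurable_id
  · exact h
  · intro j j' hjj' l l' h
    rcases ha hjj' with h1 | h1 <;> omega

/-- Two `r`-separated windows are independent. -/
theorem indepFun_window (hξ : ∀ i, Measurable (ξ i)) (hind : iIndepFun ξ P) {r a b : ℕ}
    (hab : a + r ≤ b) : IndepFun (window ξ r a) (window ξ r b) P := by
  have h := iIndepFun_window hξ hind (κ := Bool) (a := fun c => cond c a b) (r := r) ?_
  · exact h.indepFun (i := true) (j := false) (by simp)
  · intro j j' hjj'
    cases j <;> cases j' <;> simp_all

end IID

/-! ## The block-factor process: stationarity up to second order and `m`-dependence -/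

section Process

variable {ξ : ℕ → Ω → S} {m : ℕ} {F : (Fin (m + 1) → S) → ℝ}

/-- Every `X_i` has the law of `X_0`. -/
theorem identDistrib_blockFactor (hind : iIndepFun ξ P) (hid : ∀ i, IdentDistrib (ξ i) (ξ 0) P P)
    (hF : Measurable F) (i : ℕ) :
    IdentDistrib (blockFactor F ξ i) (blockFactor F ξ 0) P P :=
  (identDistrib_window hind hid (m + 1) i).comp hF

omit [MeasurableSpace Ω] [MeasurableSpace S] in
/-- The pair `(X_a, X_{a+k})` as ONE measurable function of the window of length `k + m + 1` at
`a`. -/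
theorem blockFactor_pair_eq (F : (Fin (m + 1) → S) → ℝ) (ξ : ℕ → Ω → S) (a k : ℕ) :
    (fun ω => (blockFactor F ξ a ω, blockFactor F ξ (a + k) ω))
      = fun ω => (fun w : Fin (k + m + 1) → S =>
          (F (fun j : Fin (m + 1) => w ⟨0 + j, by omega⟩),
            F (fun j : Fin (m + 1) => w ⟨k + j, by omega⟩))) (window ξ (k + m + 1) a ω) := by
  funext ω
  simp only [blockFactor_apply, window_add, add_zero]

omit [MeasurableSpace Ω] in
/-- Measurability of the pair map of `blockFactor_pair_eq`. -/
theorem measurable_pairMap (hF : Measurable F) (k : ℕ) :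
    Measurable fun w : Fin (k + m + 1) → S =>
      (F (fun j : Fin (m + 1) => w ⟨0 + j, by omega⟩),
        F (fun j : Fin (m + 1) => w ⟨k + j, by omega⟩)) :=
  Measurable.prodMk (hF.comp (measurable_pi_lambda _ fun _ => measurable_pi_apply _))
    (hF.comp (measurable_pi_lambda _ fun _ => measurable_pi_apply _))

/-- The pair `(X_i, X_{i+k})` has the law of `(X_0, X_k)` (both are the same measurable function of
a window of length `k + m + 1`). -/
theorem identDistrib_blockFactor_pair (hind : iIndepFun ξ P)
    (hid : ∀ i, IdentDistrib (ξ i) (ξ 0) P P) (hF : Measurable F) (i k : ℕ) :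
    IdentDistrib (fun ω => (blockFactor F ξ i ω, blockFactor F ξ (i + k) ω))
      (fun ω => (blockFactor F ξ 0 ω, blockFactor F ξ k ω)) P P := by
  have h0 : (fun ω => (blockFactor F ξ 0 ω, blockFactor F ξ k ω))
      = fun ω => (blockFactor F ξ 0 ω, blockFactor F ξ (0 + k) ω) := by
    simp only [zero_add]
  rw [h0, blockFactor_pair_eq F ξ i k, blockFactor_pair_eq F ξ 0 k]
  exact (identDistrib_window hind hid (k + m + 1) i).comp (measurable_pairMap hF k)

/-- Square integrability of every `X_i` from that of `X_0`. -/
theorem memLp_blockFactor (hind : iIndepFun ξ P) (hid : ∀ i, IdentDistrib (ξ i) (ξ 0) P P)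
    (hF : Measurable F) (h2 : MemLp (blockFactor F ξ 0) 2 P) (i : ℕ) :
    MemLp (blockFactor F ξ i) 2 P :=
  (identDistrib_blockFactor hind hid hF i).symm.memLp_snd h2

/-- **Stationarity of the mean**: `E X_i = E X_0`. -/
theorem integral_blockFactor (hind : iIndepFun ξ P) (hid : ∀ i, IdentDistrib (ξ i) (ξ 0) P P)
    (hF : Measurable F) (i : ℕ) :
    P[blockFactor F ξ i] = P[blockFactor F ξ 0] :=
  (identDistrib_blockFactor hind hid hF i).integral_eq

/-- **Stationarity of the autocovariance**: `cov[X_i, X_{i+k}] = cov[X_0, X_k]`. -/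
theorem covariance_blockFactor_add [IsProbabilityMeasure P] (hind : iIndepFun ξ P)
    (hid : ∀ i, IdentDistrib (ξ i) (ξ 0) P P) (hF : Measurable F)
    (h2 : MemLp (blockFactor F ξ 0) 2 P) (i k : ℕ) :
    cov[blockFactor F ξ i, blockFactor F ξ (i + k); P]
      = cov[blockFactor F ξ 0, blockFactor F ξ k; P] := by
  have hp := identDistrib_blockFactor_pair hind hid hF i k
  have hm := fun a => memLp_blockFactor hind hid hF h2 a
  rw [covariance_eq_sub (hm i) (hm (i + k)), covariance_eq_sub (hm 0) (hm k)]
  have e1 : P[blockFactor F ξ i * blockFactor F ξ (i + k)]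
      = P[blockFactor F ξ 0 * blockFactor F ξ k] :=
    (hp.comp (u := fun p : ℝ × ℝ => p.1 * p.2) (by fun_prop)).integral_eq
  rw [e1, integral_blockFactor hind hid hF i, integral_blockFactor hind hid hF (i + k),
    integral_blockFactor hind hid hF k]

/-- **`m`-dependence**: `X_i` and `X_j` are independent once `j ≥ i + m + 1` (their windows are
disjoint). -/
theorem indepFun_blockFactor (hξ : ∀ i, Measurable (ξ i)) (hind : iIndepFun ξ P)
    (hF : Measurable F) {i j : ℕ} (hij : i + (m + 1) ≤ j) :
    IndepFun (blockFactor F ξ i) (blockFactor F ξ j) P :=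
  (indepFun_window hξ hind hij).comp hF hF

end Process

/-! ## Block sums: one measurable function of one window each -/

section BlockSums

variable {ξ : ℕ → Ω → S} {m : ℕ} {F : (Fin (m + 1) → S) → ℝ}

/-- The CENTRED BLOCK SUM of `n` consecutive terms from position `a`:
`Σ_{l<n} (X_{a+l} − μ)`. [ours] -/
def cblockSum (X : ℕ → Ω → ℝ) (μ : ℝ) (a n : ℕ) : Ω → ℝ :=
  fun ω => ∑ l ∈ range n, (X (a + l) ω - μ)

omit [MeasurableSpace Ω] in
/-- Unfolding lemma for `cblockSum`. -/
theorem cblockSum_apply (X : ℕ → Ω → ℝ) (μ : ℝ) (a n : ℕ) (ω : Ω) :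
    cblockSum X μ a n ω = ∑ l ∈ range n, (X (a + l) ω - μ) := rfl

omit [MeasurableSpace Ω] in
/-- Splitting a block: `Σ_{l<n+n'} = Σ_{l<n} + Σ_{l<n'}` (shifted by `n`). -/
theorem cblockSum_add (X : ℕ → Ω → ℝ) (μ : ℝ) (a n n' : ℕ) (ω : Ω) :
    cblockSum X μ a (n + n') ω = cblockSum X μ a n ω + cblockSum X μ (a + n) n' ω := by
  simp only [cblockSum_apply, sum_range_add, add_assoc]

omit [MeasurableSpace Ω] in
/-- Concatenating `n` consecutive blocks of length `p`: `Σ_{i < n p} = Σ_{j<n} (block at j p)`. -/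
theorem cblockSum_mul (X : ℕ → Ω → ℝ) (μ : ℝ) (p : ℕ) (ω : Ω) :
    ∀ n : ℕ, cblockSum X μ 0 (n * p) ω = ∑ j ∈ range n, cblockSum X μ (j * p) p ω
  | 0 => by simp [cblockSum_apply]
  | n + 1 => by
    rw [show (n + 1) * p = n * p + p by ring, cblockSum_add, cblockSum_mul X μ p ω n,
      sum_range_succ, zero_add]

omit [MeasurableSpace S] in
/-- The map `w ↦ Σ_{l<n} (F(w_{l}, …, w_{l+m}) − μ)` on windows of length `n + m`. [ours] -/
def blockSumMap (F : (Fin (m + 1) → S) → ℝ) (μ : ℝ) (n : ℕ) : (Fin (n + m) → S) → ℝ :=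
  fun w => ∑ l : Fin n, (F (fun j : Fin (m + 1) => w ⟨l + j, by omega⟩) - μ)

omit [MeasurableSpace Ω] in
/-- Measurability of `blockSumMap`. -/
theorem measurable_blockSumMap (hF : Measurable F) (μ : ℝ) (n : ℕ) :
    Measurable (blockSumMap F μ n) := by
  refine Finset.measurable_sum _ fun l _ => ?_
  exact (hF.comp (measurable_pi_lambda _ fun _ => measurable_pi_apply _)).sub_const μ

omit [MeasurableSpace Ω] [MeasurableSpace S] in
/-- **A centred block sum of a block-factor process is one function of one window**:
`Σ_{l<n} (X_{a+l} − μ) = blockSumMap F μ n (ξ_a, …, ξ_{a+n+m-1})`. -/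
theorem cblockSum_blockFactor_eq (F : (Fin (m + 1) → S) → ℝ) (ξ : ℕ → Ω → S) (μ : ℝ) (a n : ℕ) :
    cblockSum (blockFactor F ξ) μ a n = fun ω => blockSumMap F μ n (window ξ (n + m) a ω) := by
  funext ω
  rw [cblockSum_apply, blockSumMap, ← Fin.sum_univ_eq_sum_range]
  refine sum_congr rfl fun l _ => ?_
  simp only [blockFactor_apply, window_add]

/-- Centred block sums are measurable. -/
theorem measurable_cblockSum (hξ : ∀ i, Measurable (ξ i)) (hF : Measurable F) (μ : ℝ) (a n : ℕ) :
    Measurable (cblockSum (blockFactor F ξ) μ a n) := by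
  rw [cblockSum_blockFactor_eq]
  exact (measurable_blockSumMap hF μ n).comp (measurable_window hξ _ _)

/-- **Stationarity of block sums**: the block at `a` has the law of the block at `0`. -/
theorem identDistrib_cblockSum (hind : iIndepFun ξ P) (hid : ∀ i, IdentDistrib (ξ i) (ξ 0) P P)
    (hF : Measurable F) (μ : ℝ) (a n : ℕ) :
    IdentDistrib (cblockSum (blockFactor F ξ) μ a n) (cblockSum (blockFactor F ξ) μ 0 n) P P := by
  rw [cblockSum_blockFactor_eq, cblockSum_blockFactor_eq]
  exact (identDistrib_window hind hid (n + m) a).comp (measurable_blockSumMap hF μ n)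

/-- **Independence of separated block sums** (Bernstein blocks): blocks of length `n` at positions
`a j` that are pairwise `(n + m)`-separated are mutually independent. -/
theorem iIndepFun_cblockSum (hξ : ∀ i, Measurable (ξ i)) (hind : iIndepFun ξ P)
    (hF : Measurable F) (μ : ℝ) {κ : Type*} {a : κ → ℕ} {n : ℕ}
    (ha : Pairwise fun j j' => a j + (n + m) ≤ a j' ∨ a j' + (n + m) ≤ a j) :
    iIndepFun (fun j => cblockSum (blockFactor F ξ) μ (a j) n) P := by
  simp_rw [cblockSum_blockFactor_eq]
  exact (iIndepFun_window hξ hind ha).comp (fun _ => blockSumMap F μ n)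
    fun _ => measurable_blockSumMap hF μ n

/-- Consecutive blocks of length `n` with period `p ≥ n + m` (offset `c`) are mutually independent. -/
theorem iIndepFun_cblockSum_periodic (hξ : ∀ i, Measurable (ξ i)) (hind : iIndepFun ξ P)
    (hF : Measurable F) (μ : ℝ) {n p c : ℕ} (hp : n + m ≤ p) :
    iIndepFun (fun j : ℕ => cblockSum (blockFactor F ξ) μ (j * p + c) n) P := by
  refine iIndepFun_cblockSum hξ hind hF μ (a := fun j : ℕ => j * p + c) fun j j' hjj' => ?_
  rcases lt_or_gt_of_ne hjj' with h | h
  · left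
    have : (j + 1) * p ≤ j' * p := Nat.mul_le_mul_right p h
    nlinarith
  · right
    have : (j' + 1) * p ≤ j * p := Nat.mul_le_mul_right p h
    nlinarith

variable [IsProbabilityMeasure P]

/-- Block sums are square integrable. -/
theorem memLp_cblockSum (hind : iIndepFun ξ P) (hid : ∀ i, IdentDistrib (ξ i) (ξ 0) P P)
    (hF : Measurable F) (h2 : MemLp (blockFactor F ξ 0) 2 P) (μ : ℝ) (a n : ℕ) :
    MemLp (cblockSum (blockFactor F ξ) μ a n) 2 P :=
  memLp_finsetSum _ fun l _ => (memLp_blockFactor hind hid hF h2 (a + l)).sub (memLp_const μ)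

/-- **Centred block sums have mean zero** (`μ = E X_0`). -/
theorem integral_cblockSum (hind : iIndepFun ξ P) (hid : ∀ i, IdentDistrib (ξ i) (ξ 0) P P)
    (hF : Measurable F) (h2 : MemLp (blockFactor F ξ 0) 2 P) (a n : ℕ) :
    P[cblockSum (blockFactor F ξ) (P[blockFactor F ξ 0]) a n] = 0 := by
  have hint : ∀ l ∈ range n,
      Integrable (fun ω => blockFactor F ξ (a + l) ω - P[blockFactor F ξ 0]) P := fun l _ =>
    ((memLp_blockFactor hind hid hF h2 (a + l)).integrable one_le_two).sub (integrable_const _)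
  simp only [cblockSum]
  rw [integral_finsetSum _ hint]
  refine sum_eq_zero fun l _ => ?_
  rw [integral_sub ((memLp_blockFactor hind hid hF h2 (a + l)).integrable one_le_two)
    (integrable_const _), integral_blockFactor hind hid hF (a + l)]
  simp

end BlockSums

end Summit.Ventures.LatticeQCDFlow.Scoring

end
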